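import Summits.NavierStokesRegularity.NavierStokesRegularity.Theorems.TypeICertificateLadderTargetRssCompactnessLimit
import Summits.NavierStokesRegularity.NavierStokesRegularity.Theorems.TypeICertificateLadderTargetRssCompactnessClassical
import HarnessLib

/-!
# Crux `Target` (stmt-NavierStokesRegularity-1217), line `killing-twisted-bernoulli-solitons`,
  stub B5b `stub_windowLiouville`: THE TOPOLOGY OF THE WINDOW

Support file (theorems only, `--supports stmt-NavierStokesRegularity-1217`). Write, for a Type-I
constant `C₀` and a rotation speed `α`,

  `L(C₀, α)` := every classical solution `(u, p)` of Navier–Stokes (`ν = 1`) on `ℝ³ × [−1, 0)` with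
  the Type-I bound `‖u(t,x)‖ ≤ C₀/(‖x‖ + √−t)` which is rotated self-similar with speed `α` and a
  `C²` profile `U` (`u = pvAnsatz α U`, Pineau–Vicol (1.7)) has `U = 0`

— the hypothesis list of `pineauVicol2026_rss_liouville` at ONE speed, i.e. the `hL` of the line's
composition `rateClassLiouville_of_parts` / the content of stub B5b at one `α` (spelled out below; no
definition is introduced). Pineau–Vicol Conj. 1.1 (= Tsai GSM 192 Conj. 8.9) says `L(C₀, α)` for
all `α ≠ 0`; Theorem 1.4 (tree, discharged: `pineauVicol2026_rss_liouville_holds`) gives it for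
`|α| < α₁(C₀)` and `|α| > α₂(C₀)`; the line's stub B5b is the compact window in between.

Results (all unconditional):

* `rssCompact_liouvilleAt_nhds` — **OPENNESS**: `L(C₀, α₀)` implies `L(C₀, α)` for all `α` near
  `α₀`. Chae–Wolf's indirect compactness argument (Comm. PDE 42 (2017) §3) run with `α_n → α₀`:
  counterexamples with `α_n → α₀` extend backwards (footnote 13), have a locally uniform limit
  (`rssCompact_exists_limit`) which is RSS-symmetric with speed `α₀`, Type-I with the same
  constant, non-trivial at `t = −1`, and — the new step, `rssCompact_limit_classical` — a CLASSICAL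
  Pineau–Vicol-class solution with a smooth profile, contradicting `L(C₀, α₀)`.
* `rssCompact_isOpen_good` / `rssCompact_isClosed_bad` / `rssCompact_bad_subset_window` /
  `rssCompact_isCompact_bad` — at each level `C₀ > 0` the set of BAD speeds (those carrying a
  non-trivial Type-I RSS profile) is a compact subset of `{α₁(C₀) ≤ |α| ≤ α₂(C₀)}`.
* `rssCompact_exists_extremal_speeds` — if Conj. 1.1 fails at level `C₀`, there are bad speeds of
  LEAST and of LARGEST modulus (so B5b at level `C₀` follows from DESCENT in `|α|`:
  `rssCompact_liouville_of_descent_speed`, in `…RssCompactnessMinimal.lean`).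
* `rssCompact_liouvilleAt_anti` (monotonicity in `C₀`), `rssCompact_good_of_small_constant`
  (`C₀ ≤ ε₀` is good, Chae–Wolf's smallness constant). Closedness in the `(C₀, α)` plane and the
  MINIMAL bad constant are in `TypeICertificateLadderTargetRssCompactnessMinimal.lean`.

Honest scope: nothing here makes the window empty — B5b (P–V Conj. 1.1 at `α ≈ 1`) stays OPEN.
What the file adds is structure a direct attack can use: every individually settled speed clears a
neighbourhood; a counterexample may be assumed EXTREMAL (least `|α|`, or least constant `C₀`).

## References

* B. Pineau, V. Vicol, arXiv:2607.09619 (2026): Conj. 1.1, Remarks 1.2–1.5, **Theorem 1.4** (p. 4),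
  p. 6 (compactness as an alternative proof), footnote 13. [PineauVicol2026]
* D. Chae, J. Wolf, Comm. PDE 42 (2017) 1359–1374 = arXiv:1610.09464, Thm. 1.3 and §3.
  [ChaeWolf2017RemovingDSS]
* T.-P. Tsai, *Lectures on Navier–Stokes equations*, GSM 192 (2018), Conj. 8.9. [Tsai2018]
-/

noncomputable section

namespace Summit.NavierStokesRegularity.NavierStokesRegularity.Theorems

open MeasureTheory Set Function Filter Metric Real
open scoped Topology ENNReal NNReal ContDiff
open Literature.Analysis.FluidPDE Literature.Analysis.FluidPDE.PineauVicol2026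

/-! ### The Liouville property at one speed, and its failure witnesses -/

section LiouvilleAt


/-- **From a limit to a counterexample at the limit speed.** If a continuous field `v` on
`ℝ × ℝ³` obeys the Type-I bound with constant `C⋆` on `t ≤ −1/4`, `t ↦ v(t − 1/4)` is a bounded weak
solution on `(−∞, 0)`, `v` is RSS-symmetric with speed `α⋆`, and `v(−1) ≠ 0` somewhere, then the
Liouville property FAILS at `(C⋆, α⋆)`: the ansatz field of the smooth profile `v(−1)` is a
non-trivial Type-I RSS classical solution of Pineau–Vicol's class
(`rssCompact_limit_classical`). [cite: ChaeWolf2017RemovingDSS, §3; PineauVicol2026, Theorem 1.4 (class) and Remark 1.2] -/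
theorem rssCompact_not_liouvilleAt_of_limit {Cstar αstar : ℝ} {v : ℝ → EuclideanSpace ℝ (Fin 3) → EuclideanSpace ℝ (Fin 3)}
    (hvc : Continuous (uncurry v))
    (hvI : ∀ t ≤ -(1 / 4 : ℝ), ∀ x, ‖v t x‖ ≤ Cstar / (‖x‖ + √(-t)))
    (hweak : IsBoundedWeakNSSolutionOn (Iio 0) isOpen_Iio 1 (fun t => v (t - 1 / 4)))
    (hss : ∀ μ : ℝ, 1 ≤ μ → ∀ t ≤ -(1 / 4 : ℝ), ∀ x,
      v t x = μ • rotZ (αstar * (2 * Real.log μ)) (v (μ ^ 2 * t) (μ • rotZ (-(αstar * (2 * Real.log μ))) x)))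
    (hnt : ∃ x, v (-1) x ≠ 0) :
    ¬ (∀ (u : ℝ → EuclideanSpace ℝ (Fin 3) → EuclideanSpace ℝ (Fin 3)) (p : ℝ → EuclideanSpace ℝ (Fin 3) → ℝ) (U : EuclideanSpace ℝ (Fin 3) → EuclideanSpace ℝ (Fin 3)),
        IsClassicalNSSolutionOn (Ico (-1) 0) 1 0 u p →
        (∀ t ∈ Ico (-1 : ℝ) 0, ∀ x : EuclideanSpace ℝ (Fin 3), ‖u t x‖ ≤ Cstar / (‖x‖ + Real.sqrt (-t))) →
        ContDiff ℝ 2 U →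
        (∀ t ∈ Ico (-1 : ℝ) 0, ∀ x : EuclideanSpace ℝ (Fin 3), u t x = pvAnsatz αstar (fun y _ => U y) t x) → U = 0) := by
  intro hL
  obtain ⟨hprof, ⟨P, hP⟩, hI, -⟩ := rssCompact_limit_classical Cstar αstar v hvc hvI hweak hss
  obtain ⟨x, hx⟩ := hnt
  have hcl : IsClassicalNSSolutionOn (Ico (-1) 0) 1 0 (pvAnsatz αstar (fun y _ => v (-1) y)) P :=
    hP.mono Ico_subset_Iio_self (uniqueDiffOn_Ico _ _)
  have h2 : ContDiff ℝ 2 (v (-1)) := contDiff_infty.1 hprof 2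
  have hzero := hL _ P (v (-1)) hcl (fun t ht y => hI t ht.2 y) h2 fun _ _ _ => rfl
  exact hx (by rw [hzero]; rfl)

/-- **Backward extension and Type-I bound of a counterexample (footnote 13, Remark 1.2).** A
classical solution on `[−1, 0)` which is the RSS ansatz of a profile `U` there and obeys the Type-I
bound with constant `C₀` yields: the ansatz field `pvAnsatz α U` is a classical solution on
`(−∞, 0)` for some pressure and obeys `HasTypeIDecay C₀`. [cite: PineauVicol2026, §2 footnote 13 and Remark 1.2 (arXiv:2607.09619 pp. 4, 10)] -/
theorem rssCompact_extend {α C₀ : ℝ} {u : ℝ → EuclideanSpace ℝ (Fin 3) → EuclideanSpace ℝ (Fin 3)} {p : ℝ → EuclideanSpace ℝ (Fin 3) → ℝ} {U : EuclideanSpace ℝ (Fin 3) → EuclideanSpace ℝ (Fin 3)}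
    (hsol : IsClassicalNSSolutionOn (Ico (-1) 0) 1 0 u p)
    (hI : ∀ t ∈ Ico (-1 : ℝ) 0, ∀ x : EuclideanSpace ℝ (Fin 3), ‖u t x‖ ≤ C₀ / (‖x‖ + Real.sqrt (-t)))
    (hans : ∀ t ∈ Ico (-1 : ℝ) 0, ∀ x : EuclideanSpace ℝ (Fin 3), u t x = pvAnsatz α (fun y _ => U y) t x) :
    (∃ P : ℝ → EuclideanSpace ℝ (Fin 3) → ℝ, IsClassicalNSSolutionOn (Iio 0) 1 0 (pvAnsatz α (fun y _ => U y)) P) ∧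
      HasTypeIDecay C₀ (pvAnsatz α (fun y _ => U y)) := by
  refine ⟨exists_isClassicalNSSolutionOn_Iio_of_isRotatedDSS hsol one_lt_two
    (isRotatedDSS_pvAnsatz (α := α) (U := fun y _ => U y) two_pos fun _ _ => rfl) hans, ?_⟩
  exact fun t ht x => norm_pvAnsatz_le_of_profile (profile_bound_of_typeI hI hans) ht x

/-- **OPENNESS of the RSS Liouville property in the rotation speed.** For every `C₀ > 0` and
every `α₀`: if every Type-I (constant `C₀`) RSS classical solution of Pineau–Vicol's class with
speed `α₀` is trivial, then the same holds for all speeds `α` in a neighbourhood of `α₀`. Proof by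
contradiction (Chae–Wolf 2017 §3 run with `α_n → α₀`): otherwise there are non-trivial such
solutions with `α_n → α₀`; they extend to `(−∞, 0)` with the same constant (`rssCompact_extend`),
a subsequence has a locally uniform RSS-symmetric limit of speed `α₀`, non-trivial at `t = −1`
(`rssCompact_exists_limit`), and that limit is a classical Pineau–Vicol-class counterexample at
`(C₀, α₀)` (`rssCompact_not_liouvilleAt_of_limit`). New (not in the source, which proves the two
extreme regimes); nearest prior art: the source's remark (p. 6) that compactness re-proves the
large-`|α|` case. [cite: PineauVicol2026, Theorem 1.4 and p. 6; ChaeWolf2017RemovingDSS, §3] -/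
theorem rssCompact_liouvilleAt_nhds :
    ∀ (C₀ : ℝ), 0 < C₀ → ∀ (α₀ : ℝ), (∀ (u : ℝ → EuclideanSpace ℝ (Fin 3) → EuclideanSpace ℝ (Fin 3)) (p : ℝ → EuclideanSpace ℝ (Fin 3) → ℝ) (U : EuclideanSpace ℝ (Fin 3) → EuclideanSpace ℝ (Fin 3)), Literature.Analysis.FluidPDE.IsClassicalNSSolutionOn (Set.Ico (-1) 0) 1 0 u p → (∀ t ∈ Set.Ico (-1 : ℝ) 0, ∀ x : EuclideanSpace ℝ (Fin 3), ‖u t x‖ ≤ C₀ / (‖x‖ + Real.sqrt (-t))) → ContDiff ℝ 2 U → (∀ t ∈ Set.Ico (-1 : ℝ) 0, ∀ x : EuclideanSpace ℝ (Fin 3), u t x = Literature.Analysis.FluidPDE.pvAnsatz α₀ (fun y _ => U y) t x) → U = 0) → ∀ᶠ α in nhds α₀, ∀ (u : ℝ → EuclideanSpace ℝ (Fin 3) → EuclideanSpace ℝ (Fin 3)) (p : ℝ → EuclideanSpace ℝ (Fin 3) → ℝ) (U : EuclideanSpace ℝ (Fin 3) → EuclideanSpace ℝ (Fin 3)), Literature.Analysis.FluidPDE.IsClassicalNSSolutionOn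 (Set.Ico (-1) 0) 1 0 u p → (∀ t ∈ Set.Ico (-1 : ℝ) 0, ∀ x : EuclideanSpace ℝ (Fin 3), ‖u t x‖ ≤ C₀ / (‖x‖ + Real.sqrt (-t))) → ContDiff ℝ 2 U → (∀ t ∈ Set.Ico (-1 : ℝ) 0, ∀ x : EuclideanSpace ℝ (Fin 3), u t x = Literature.Analysis.FluidPDE.pvAnsatz α (fun y _ => U y) t x) → U = 0 := by
  intro C₀ hC₀ α₀ hL
  by_contra H
  rw [Filter.not_eventually] at H
  -- counterexamples with `α_n → α₀`: use the balls of radius `1/(n+1)`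
  have H' : ∀ n : ℕ, ∃ α : ℝ, |α - α₀| < 1 / ((n : ℝ) + 1) ∧
      ∃ (u : ℝ → EuclideanSpace ℝ (Fin 3) → EuclideanSpace ℝ (Fin 3)) (p : ℝ → EuclideanSpace ℝ (Fin 3) → ℝ) (U : EuclideanSpace ℝ (Fin 3) → EuclideanSpace ℝ (Fin 3)),
        IsClassicalNSSolutionOn (Ico (-1) 0) 1 0 u p ∧
        (∀ t ∈ Ico (-1 : ℝ) 0, ∀ x : EuclideanSpace ℝ (Fin 3), ‖u t x‖ ≤ C₀ / (‖x‖ + Real.sqrt (-t))) ∧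
        ContDiff ℝ 2 U ∧
        (∀ t ∈ Ico (-1 : ℝ) 0, ∀ x : EuclideanSpace ℝ (Fin 3), u t x = pvAnsatz α (fun y _ => U y) t x) ∧ U ≠ 0 := by
    intro n
    have hpos : (0 : ℝ) < 1 / ((n : ℝ) + 1) := by positivity
    obtain ⟨α, hαbad, hαmem⟩ := (H.and_eventually (Metric.ball_mem_nhds α₀ hpos)).exists
    refine ⟨α, by rw [← Real.dist_eq]; exact hαmem, ?_⟩
    push Not at hαbad
    obtain ⟨u, p, U, h1, h2, h3, h4, h5⟩ := hαbad
    exact ⟨u, p, U, h1, h2, h3, h4, h5⟩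
  choose α hαd u p U hsol hI _hU2 hans hne using H'
  -- backward extensions with the same Type-I constant
  have hext := fun n => rssCompact_extend (hsol n) (hI n) (hans n)
  choose P hP using fun n => (hext n).1
  have hIw : ∀ n, HasTypeIDecay C₀ (pvAnsatz (α n) (fun y _ => U n y)) := fun n => (hext n).2
  -- `α n → α₀`
  have hα0 : Tendsto α atTop (𝓝 α₀) := by
    rw [tendsto_iff_norm_sub_tendsto_zero]
    exact squeeze_zero (fun n => norm_nonneg _) (fun n => by
      rw [Real.norm_eq_abs]; exact (hαd n).le) tendsto_one_div_add_atTop_nhds_zero_nat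
  obtain ⟨v, hvc, hvI, hweak, hss, x, hx⟩ := rssCompact_exists_limit C₀ C₀ α₀ (fun _ => C₀) α U P hC₀
    (fun _ => hC₀.le) (fun _ => le_rfl) tendsto_const_nhds hα0 hP hIw hne
  exact rssCompact_not_liouvilleAt_of_limit hvc hvI hweak hss ⟨x, hx⟩ hL

/-- **The good set is open.** For `C₀ > 0`, the set of speeds `α` at which the Type-I (constant
`C₀`) RSS Liouville property of Pineau–Vicol's class holds is open. [cite: PineauVicol2026, Theorem 1.4 and Conj. 1.1; ChaeWolf2017RemovingDSS, §3] -/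
theorem rssCompact_isOpen_good {C₀ : ℝ} (hC₀ : 0 < C₀) :
    IsOpen {α : ℝ | ∀ (u : ℝ → EuclideanSpace ℝ (Fin 3) → EuclideanSpace ℝ (Fin 3)) (p : ℝ → EuclideanSpace ℝ (Fin 3) → ℝ) (U : EuclideanSpace ℝ (Fin 3) → EuclideanSpace ℝ (Fin 3)),
        IsClassicalNSSolutionOn (Ico (-1) 0) 1 0 u p →
        (∀ t ∈ Ico (-1 : ℝ) 0, ∀ x : EuclideanSpace ℝ (Fin 3), ‖u t x‖ ≤ C₀ / (‖x‖ + Real.sqrt (-t))) →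
        ContDiff ℝ 2 U →
        (∀ t ∈ Ico (-1 : ℝ) 0, ∀ x : EuclideanSpace ℝ (Fin 3), u t x = pvAnsatz α (fun y _ => U y) t x) → U = 0} := by
  rw [isOpen_iff_mem_nhds]
  intro α₀ hα₀
  exact rssCompact_liouvilleAt_nhds C₀ hC₀ α₀ hα₀

/-- **The bad set is closed.** For `C₀ > 0`, the set of speeds carrying a NON-TRIVIAL Type-I
(constant `C₀`) RSS classical solution of Pineau–Vicol's class is closed. [cite: PineauVicol2026, Conj. 1.1; ChaeWolf2017RemovingDSS, §3] -/
theorem rssCompact_isClosed_bad {C₀ : ℝ} (hC₀ : 0 < C₀) :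
    IsClosed {α : ℝ | ∃ (u : ℝ → EuclideanSpace ℝ (Fin 3) → EuclideanSpace ℝ (Fin 3)) (p : ℝ → EuclideanSpace ℝ (Fin 3) → ℝ) (U : EuclideanSpace ℝ (Fin 3) → EuclideanSpace ℝ (Fin 3)),
        IsClassicalNSSolutionOn (Ico (-1) 0) 1 0 u p ∧
        (∀ t ∈ Ico (-1 : ℝ) 0, ∀ x : EuclideanSpace ℝ (Fin 3), ‖u t x‖ ≤ C₀ / (‖x‖ + Real.sqrt (-t))) ∧
        ContDiff ℝ 2 U ∧
        (∀ t ∈ Ico (-1 : ℝ) 0, ∀ x : EuclideanSpace ℝ (Fin 3), u t x = pvAnsatz α (fun y _ => U y) t x) ∧ U ≠ 0} := by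
  have hset : {α : ℝ | ∃ (u : ℝ → EuclideanSpace ℝ (Fin 3) → EuclideanSpace ℝ (Fin 3)) (p : ℝ → EuclideanSpace ℝ (Fin 3) → ℝ) (U : EuclideanSpace ℝ (Fin 3) → EuclideanSpace ℝ (Fin 3)),
        IsClassicalNSSolutionOn (Ico (-1) 0) 1 0 u p ∧
        (∀ t ∈ Ico (-1 : ℝ) 0, ∀ x : EuclideanSpace ℝ (Fin 3), ‖u t x‖ ≤ C₀ / (‖x‖ + Real.sqrt (-t))) ∧
        ContDiff ℝ 2 U ∧
        (∀ t ∈ Ico (-1 : ℝ) 0, ∀ x : EuclideanSpace ℝ (Fin 3), u t x = pvAnsatz α (fun y _ => U y) t x) ∧ U ≠ 0} =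
      {α : ℝ | ∀ (u : ℝ → EuclideanSpace ℝ (Fin 3) → EuclideanSpace ℝ (Fin 3)) (p : ℝ → EuclideanSpace ℝ (Fin 3) → ℝ) (U : EuclideanSpace ℝ (Fin 3) → EuclideanSpace ℝ (Fin 3)),
        IsClassicalNSSolutionOn (Ico (-1) 0) 1 0 u p →
        (∀ t ∈ Ico (-1 : ℝ) 0, ∀ x : EuclideanSpace ℝ (Fin 3), ‖u t x‖ ≤ C₀ / (‖x‖ + Real.sqrt (-t))) →
        ContDiff ℝ 2 U →
        (∀ t ∈ Ico (-1 : ℝ) 0, ∀ x : EuclideanSpace ℝ (Fin 3), u t x = pvAnsatz α (fun y _ => U y) t x) → U = 0}ᶜ := by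
    ext α
    simp only [mem_setOf_eq, mem_compl_iff]
    constructor
    · rintro ⟨u, p, U, h1, h2, h3, h4, h5⟩ hall
      exact h5 (hall u p U h1 h2 h3 h4)
    · intro h
      by_contra hcon
      apply h
      intro u p U h1 h2 h3 h4
      by_contra h5
      exact hcon ⟨u, p, U, h1, h2, h3, h4, h5⟩
  rw [hset]
  exact (rssCompact_isOpen_good hC₀).isClosed_compl

/-- **The bad set lies in the window of Theorem 1.4.** For `C₀ > 0` there are `α₁, α₂ > 0`
(Pineau–Vicol's thresholds) such that every bad speed satisfies `α₁ ≤ |α| ≤ α₂`. [cite: PineauVicol2026, Theorem 1.4 (arXiv:2607.09619 p. 4)] -/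
theorem rssCompact_bad_subset_window {C₀ : ℝ} (hC₀ : 0 < C₀) :
    ∃ α₁ α₂ : ℝ, 0 < α₁ ∧ 0 < α₂ ∧
      {α : ℝ | ∃ (u : ℝ → EuclideanSpace ℝ (Fin 3) → EuclideanSpace ℝ (Fin 3)) (p : ℝ → EuclideanSpace ℝ (Fin 3) → ℝ) (U : EuclideanSpace ℝ (Fin 3) → EuclideanSpace ℝ (Fin 3)),
        IsClassicalNSSolutionOn (Ico (-1) 0) 1 0 u p ∧
        (∀ t ∈ Ico (-1 : ℝ) 0, ∀ x : EuclideanSpace ℝ (Fin 3), ‖u t x‖ ≤ C₀ / (‖x‖ + Real.sqrt (-t))) ∧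
        ContDiff ℝ 2 U ∧
        (∀ t ∈ Ico (-1 : ℝ) 0, ∀ x : EuclideanSpace ℝ (Fin 3), u t x = pvAnsatz α (fun y _ => U y) t x) ∧ U ≠ 0} ⊆
      {α : ℝ | α₁ ≤ |α| ∧ |α| ≤ α₂} := by
  obtain ⟨α₁, α₂, hα₁, hα₂, hPV⟩ := pineauVicol2026_rss_liouville_holds C₀ hC₀
  refine ⟨α₁, α₂, hα₁, hα₂, fun α hα => ?_⟩
  obtain ⟨u, p, U, h1, h2, h3, h4, h5⟩ := hα
  by_contra hw
  simp only [mem_setOf_eq, not_and_or, not_le] at hw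
  exact h5 (hPV α u p U h1 h2 h3 h4 hw)

/-- **COMPACTNESS of the bad set.** For `C₀ > 0`, the set of rotation speeds carrying a
non-trivial Type-I (constant `C₀`) RSS classical solution of Pineau–Vicol's class is COMPACT
(closed by `rssCompact_isClosed_bad`, bounded by Theorem 1.4). The "window" of stub B5b may thus
be taken to be this intrinsic compact set. [cite: PineauVicol2026, Theorem 1.4 and Conj. 1.1; ChaeWolf2017RemovingDSS, §3] -/
theorem rssCompact_isCompact_bad :
    ∀ (C₀ : ℝ), 0 < C₀ → IsCompact {α : ℝ | ∃ (u : ℝ → EuclideanSpace ℝ (Fin 3) → EuclideanSpace ℝ (Fin 3)) (p : ℝ → EuclideanSpace ℝ (Fin 3) → ℝ) (U : EuclideanSpace ℝ (Fin 3) → EuclideanSpace ℝ (Fin 3)), Literature.Analysis.FluidPDE.IsClassicalNSSolutionOn (Set.Ico (-1) 0) 1 0 u p ∧ (∀ t ∈ Set.Ico (-1 : ℝ) 0, ∀ x : EuclideanSpace ℝ (Fin 3), ‖u t x‖ ≤ C₀ / (‖x‖ + Real.sqrt (-t))) ∧ ContDiff ℝ 2 U ∧ (∀ t ∈ Set.Ico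 (-1 : ℝ) 0, ∀ x : EuclideanSpace ℝ (Fin 3), u t x = Literature.Analysis.FluidPDE.pvAnsatz α (fun y _ => U y) t x) ∧ U ≠ 0} := by
  intro C₀ hC₀
  obtain ⟨α₁, α₂, -, -, hsub⟩ := rssCompact_bad_subset_window hC₀
  refine (isCompact_Icc (a := -α₂) (b := α₂)).of_isClosed_subset (rssCompact_isClosed_bad hC₀)
    fun α hα => ?_
  have h := (hsub hα).2
  exact ⟨by linarith [neg_abs_le α], le_trans (le_abs_self α) h⟩

/-- **Extremal bad speeds.** For `C₀ > 0`: if some rotation speed carries a non-trivial Type-I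
(constant `C₀`) RSS classical solution of Pineau–Vicol's class (i.e. Conj. 1.1 fails at level
`C₀`), then there are bad speeds `αmin`, `αmax` of LEAST and of LARGEST modulus among all bad
speeds (continuous `|·|` on the compact bad set), and `0 < |αmin|`. [cite: PineauVicol2026, Conj. 1.1 and Theorem 1.4; ChaeWolf2017RemovingDSS, §3] -/
theorem rssCompact_exists_extremal_speeds :
    ∀ (C₀ : ℝ), 0 < C₀ → (∃ α : ℝ, ∃ (u : ℝ → EuclideanSpace ℝ (Fin 3) → EuclideanSpace ℝ (Fin 3)) (p : ℝ → EuclideanSpace ℝ (Fin 3) → ℝ) (U : EuclideanSpace ℝ (Fin 3) → EuclideanSpace ℝ (Fin 3)), Literature.Analysis.FluidPDE.IsClassicalNSSolutionOn (Set.Ico (-1) 0) 1 0 u p ∧ (∀ t ∈ Set.Ico (-1 : ℝ) 0, ∀ x : EuclideanSpace ℝ (Fin 3), ‖u t x‖ ≤ C₀ / (‖x‖ + Real.sqrt (-t))) ∧ ContDiff ℝ 2 U ∧ (∀ t ∈ Set.Ico (-1 : ℝ) 0, ∀ x : EuclideanSpace ℝ (Fin 3), u t x = Literature.Analysis.FluidPDE.pvAnsatz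 α (fun y _ => U y) t x) ∧ U ≠ 0) → ∃ αmin αmax : ℝ, 0 < |αmin| ∧ (αmin ∈ {α : ℝ | ∃ (u : ℝ → EuclideanSpace ℝ (Fin 3) → EuclideanSpace ℝ (Fin 3)) (p : ℝ → EuclideanSpace ℝ (Fin 3) → ℝ) (U : EuclideanSpace ℝ (Fin 3) → EuclideanSpace ℝ (Fin 3)), Literature.Analysis.FluidPDE.IsClassicalNSSolutionOn (Set.Ico (-1) 0) 1 0 u p ∧ (∀ t ∈ Set.Ico (-1 : ℝ) 0, ∀ x : EuclideanSpace ℝ (Fin 3), ‖u t x‖ ≤ C₀ / (‖x‖ + Real.sqrt (-t))) ∧ ContDiff ℝ 2 U ∧ (∀ t ∈ Set.Ico (-1 : ℝ) 0, ∀ x : EuclideanSpace ℝ (Fin 3), u t x = Literature.Analysis.FluidPDE.pvAnsatz α (fun y _ => U y) t x) ∧ U ≠ 0}) ∧ (αmax ∈ {α : ℝ | ∃ (u : ℝ → EuclideanSpace ℝ (Fin 3) → EuclideanSpace ℝ (Fin 3)) (p : ℝ → EuclideanSpace ℝ (Fin 3) → ℝ) (U : EuclideanSpace ℝ (Fin 3)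 → EuclideanSpace ℝ (Fin 3)), Literature.Analysis.FluidPDE.IsClassicalNSSolutionOn (Set.Ico (-1) 0) 1 0 u p ∧ (∀ t ∈ Set.Ico (-1 : ℝ) 0, ∀ x : EuclideanSpace ℝ (Fin 3), ‖u t x‖ ≤ C₀ / (‖x‖ + Real.sqrt (-t))) ∧ ContDiff ℝ 2 U ∧ (∀ t ∈ Set.Ico (-1 : ℝ) 0, ∀ x : EuclideanSpace ℝ (Fin 3), u t x = Literature.Analysis.FluidPDE.pvAnsatz α (fun y _ => U y) t x) ∧ U ≠ 0}) ∧ ∀ α ∈ {α : ℝ | ∃ (u : ℝ → EuclideanSpace ℝ (Fin 3) → EuclideanSpace ℝ (Fin 3)) (p : ℝ → EuclideanSpace ℝ (Fin 3) → ℝ) (U : EuclideanSpace ℝ (Fin 3) → EuclideanSpace ℝ (Fin 3)), Literature.Analysis.FluidPDE.IsClassicalNSSolutionOn (Set.Ico (-1) 0) 1 0 u p ∧ (∀ t ∈ Set.Ico (-1 : ℝ) 0, ∀ x : EuclideanSpace ℝ (Fin 3), ‖u t x‖ ≤ C₀ / (‖x‖ + Real.sqrt (-t))) ∧ ContDiff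 ℝ 2 U ∧ (∀ t ∈ Set.Ico (-1 : ℝ) 0, ∀ x : EuclideanSpace ℝ (Fin 3), u t x = Literature.Analysis.FluidPDE.pvAnsatz α (fun y _ => U y) t x) ∧ U ≠ 0}, |αmin| ≤ |α| ∧ |α| ≤ |αmax| := by
  intro C₀ hC₀ hbad
  obtain ⟨α', hα'⟩ := hbad
  have hK := rssCompact_isCompact_bad C₀ hC₀
  have hne : Set.Nonempty {α : ℝ | ∃ (u : ℝ → EuclideanSpace ℝ (Fin 3) → EuclideanSpace ℝ (Fin 3)) (p : ℝ → EuclideanSpace ℝ (Fin 3) → ℝ) (U : EuclideanSpace ℝ (Fin 3) → EuclideanSpace ℝ (Fin 3)),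
        IsClassicalNSSolutionOn (Ico (-1) 0) 1 0 u p ∧
        (∀ t ∈ Ico (-1 : ℝ) 0, ∀ x : EuclideanSpace ℝ (Fin 3), ‖u t x‖ ≤ C₀ / (‖x‖ + Real.sqrt (-t))) ∧
        ContDiff ℝ 2 U ∧
        (∀ t ∈ Ico (-1 : ℝ) 0, ∀ x : EuclideanSpace ℝ (Fin 3), u t x = pvAnsatz α (fun y _ => U y) t x) ∧ U ≠ 0} :=
    ⟨α', hα'⟩
  obtain ⟨αmin, hmin_mem, hmin⟩ := hK.exists_isMinOn hne continuous_abs.continuousOn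
  obtain ⟨αmax, hmax_mem, hmax⟩ := hK.exists_isMaxOn hne continuous_abs.continuousOn
  obtain ⟨α₁, α₂, hα₁, -, hsub⟩ := rssCompact_bad_subset_window hC₀
  refine ⟨αmin, αmax, lt_of_lt_of_le hα₁ (hsub hmin_mem).1, hmin_mem, hmax_mem, fun α hα => ?_⟩
  exact ⟨hmin hα, hmax hα⟩


/-- **Monotonicity in the constant.** The Liouville property at `(C₀', α)` implies it at
`(C₀, α)` for `C₀ ≤ C₀'` (a Type-I bound with a smaller constant is a Type-I bound with the larger
one). [cite: PineauVicol2026, Remark 1.3] -/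
theorem rssCompact_liouvilleAt_anti {C₀ C₀' α : ℝ} (hle : C₀ ≤ C₀')
    (hL : ∀ (u : ℝ → EuclideanSpace ℝ (Fin 3) → EuclideanSpace ℝ (Fin 3)) (p : ℝ → EuclideanSpace ℝ (Fin 3) → ℝ) (U : EuclideanSpace ℝ (Fin 3) → EuclideanSpace ℝ (Fin 3)),
        IsClassicalNSSolutionOn (Ico (-1) 0) 1 0 u p →
        (∀ t ∈ Ico (-1 : ℝ) 0, ∀ x : EuclideanSpace ℝ (Fin 3), ‖u t x‖ ≤ C₀' / (‖x‖ + Real.sqrt (-t))) →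
        ContDiff ℝ 2 U →
        (∀ t ∈ Ico (-1 : ℝ) 0, ∀ x : EuclideanSpace ℝ (Fin 3), u t x = pvAnsatz α (fun y _ => U y) t x) → U = 0) :
    ∀ (u : ℝ → EuclideanSpace ℝ (Fin 3) → EuclideanSpace ℝ (Fin 3)) (p : ℝ → EuclideanSpace ℝ (Fin 3) → ℝ) (U : EuclideanSpace ℝ (Fin 3) → EuclideanSpace ℝ (Fin 3)),
        IsClassicalNSSolutionOn (Ico (-1) 0) 1 0 u p →
        (∀ t ∈ Ico (-1 : ℝ) 0, ∀ x : EuclideanSpace ℝ (Fin 3), ‖u t x‖ ≤ C₀ / (‖x‖ + Real.sqrt (-t))) →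
        ContDiff ℝ 2 U →
        (∀ t ∈ Ico (-1 : ℝ) 0, ∀ x : EuclideanSpace ℝ (Fin 3), u t x = pvAnsatz α (fun y _ => U y) t x) → U = 0 := by
  intro u p U h1 h2 h3 h4
  refine hL u p U h1 (fun t ht x => (h2 t ht x).trans ?_) h3 h4
  have hden : 0 < ‖x‖ + Real.sqrt (-t) := by
    have : 0 < Real.sqrt (-t) := Real.sqrt_pos.2 (by linarith [ht.2])
    positivity
  exact div_le_div_of_nonneg_right hle hden.le

/-- **Small constants are good (Chae–Wolf's smallness lemma).** There is an absolute `ε₀ > 0`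
such that the Liouville property holds at every `(C₀, α)` with `0 ≤ C₀ ≤ ε₀`: the backward
extension of a solution of the class has `√(−t)‖u(t,x)‖ ≤ C₀ ≤ ε₀`, hence vanishes
(`ChaeWolf.exists_eps_typeI_small_eq_zero`), and `u(−1) = U`. [cite: ChaeWolf2017RemovingDSS, §3 Step 1; PineauVicol2026, Remark 1.2] -/
theorem rssCompact_good_of_small_constant :
    ∃ ε₀ : ℝ, 0 < ε₀ ∧ ∀ (C₀ α : ℝ), 0 ≤ C₀ → C₀ ≤ ε₀ →
      ∀ (u : ℝ → EuclideanSpace ℝ (Fin 3) → EuclideanSpace ℝ (Fin 3)) (p : ℝ → EuclideanSpace ℝ (Fin 3) → ℝ) (U : EuclideanSpace ℝ (Fin 3) → EuclideanSpace ℝ (Fin 3)),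
        IsClassicalNSSolutionOn (Ico (-1) 0) 1 0 u p →
        (∀ t ∈ Ico (-1 : ℝ) 0, ∀ x : EuclideanSpace ℝ (Fin 3), ‖u t x‖ ≤ C₀ / (‖x‖ + Real.sqrt (-t))) →
        ContDiff ℝ 2 U →
        (∀ t ∈ Ico (-1 : ℝ) 0, ∀ x : EuclideanSpace ℝ (Fin 3), u t x = pvAnsatz α (fun y _ => U y) t x) → U = 0 := by
  obtain ⟨ε₀, hε₀, hA⟩ := ChaeWolf.exists_eps_typeI_small_eq_zero
  refine ⟨ε₀, hε₀, fun C₀ α hC₀ hCε u p U hsol hI _hU hans => ?_⟩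
  obtain ⟨⟨P, hP⟩, hIw⟩ := rssCompact_extend hsol hI hans
  have hsmall : ∀ t < 0, ∀ x, √(-t) * ‖pvAnsatz α (fun y _ => U y) t x‖ ≤ ε₀ := by
    intro t ht x
    have hs : 0 < √(-t) := Real.sqrt_pos.2 (by linarith)
    have h1 := hIw t ht x
    calc √(-t) * ‖pvAnsatz α (fun y _ => U y) t x‖ ≤ √(-t) * (C₀ / (‖x‖ + √(-t))) :=
          mul_le_mul_of_nonneg_left h1 hs.le
      _ ≤ C₀ := by
          rw [mul_div_assoc']
          rw [div_le_iff₀ (by positivity)]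
          nlinarith [norm_nonneg x]
      _ ≤ ε₀ := hCε
  have hzero := hA hC₀ hP hIw hsmall (-1) (by norm_num)
  funext y
  have := hzero y
  rwa [pvAnsatz_neg_one] at this

end LiouvilleAt

end Summit.NavierStokesRegularity.NavierStokesRegularity.Theorems

end
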